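import Summits.AtomisticToContinuum.Crystallization.Theorems.ChargedEnergyGapNonAffineExchange
import HarnessLib

/-!
# ChargedEnergyGap · NODE 71 «ShellCascade», part A (lens-3 g71): the range-resolved bar truss and the three pieces beneath [BAR♮-ᶜ]

Part A of two (400-line cap): §C1 the range-resolved bar bond terms / site forms / weighted forms and the RANGE SPLIT
`barL = barNearL + barMidL + barFarL` (PROVED, under the block's `SmallStrain`); §C2 the three pieces [STIFF-ᶜ] / [MID-ᶜ] / [FAR-ᶜ], their
monotonicity, and their vanishing on rotation cocycles (PROVED).  Part B (`ChargedEnergyGapShellCascade`): §C3 the glue (PROVED), §C4 the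
nearest-neighbour reduction of [STIFF-ᶜ] to a field-free statement about the reference (PROVED) and the octahedron certificate behind [MID-ᶜ]
(PROVED, pure algebra), §C5 the record cones (16-leaf designate).

Line `stmt-AtomisticToContinuum-14231` (`PricedLinkCensus.ChargedEnergyGap`).  Node of record after NODE 70 «NonAffineExchange» (critic row 1304,
tree 70X): [COER-ᶜ](`μ₁ − ν₀`) ⟸ [BAR♮-ᶜ](`μ₁, η`) ∧ [GEO♮-ᶜ](`ν₀, η`), `c ∈ {f, h}`.  TARGET of this node, VERBATIM (the HEAVY leaf of the pair):
[BAR♮-ᶜ](`μ₁, η, c_T, cχ, r₁`) = `BarExchCls cls …` — `μ₁·springL + η·nonAffL − c_T·M_sh − cχ·M_tr − c_H·N_pr ≤ barL` over the twelve-binder block.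

WHY A RANGE SPLIT OF THE BAR FORM (and of nothing else).  Every range split tried beneath [COER]/[GEO] died on rotations (g66–g70: the prestress
form and the full second variation see rotations shell by shell, only their all-shell sums vanish, so each range piece is pinned to an irrational
virial share).  The BAR form is rotation-null BOND BY BOND (`bondBar_rotField`), so its range pieces are all rotation-null and a range split costs
nothing on the rotation sector; and the bar side is where the slack is: the renormalised stiffness `c(d) = V″(d) − V′(d)/d` of LJ(13-7) is
`+10.9` on the twelve nearest neighbours and NEGATIVE on every farther shell (`c₂ = −0.466` on the six octahedral diagonals at `√2·d₁`, `−0.115`,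
`−0.038`, … beyond, tail `≈ −8d⁻⁸`), i.e. `barSite = (c₁/4)·springSite − (mid deficit) − (far deficit)` with `c₁/4 = 2.72 … 2.74` against the
designate `μ₁ = 33/20 | 17/10`.  [BAR♮] IS a statement that two structurally different deficits — the octahedral-diagonal truss (finite, one shell,
an isostatic-cluster identity) and the long-range all-negative tail (infinitely many shells, summability) — are jointly dominated by the first-shell
truss; this node separates them and isolates the trivial-but-thin first-shell comparison.

THE SPLIT.  With `r₁ = 6/5` (the pivot's own range) and `r₂ = 3/2` (between shell 2 at `1.374` and shell 3 at `1.683`, both classes; hcp's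
c-axis pair at `2h = 1.587` is FAR): `bondBar = bondBarNear + bondBarMid + bondBarFar` (indicator split by distance, PROVED pointwise), hence
`barSite = barNearSite + barMidSite + barFarSite` and `barL = barNearL + barMidL + barFarL` under `SmallStrain` (summability from NODE 69's
`summable_bondBar`).  Pieces, each over the hypothesis block of [BAR♮-ᶜ] VERBATIM:
* [STIFF-ᶜ](`κ_B`) `NearStiffCls` — **THE FIRST SHELL OF THE RENORMALISED BAR TRUSS IS AT LEAST `κ_B` TIMES THE PIVOT**: `κ_B·springL ≤ barNearL`
  (no currencies: sitewise and bondwise).  CERT · DECIDABLE · ATTACKABLE-S: part B reduces it (PROVED) to the field-free [NN-ᶜ](`κ_B`) «every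
  non-excised pair at distance `≤ r₁` of a force-free, site-stress-free class-`c` image has `c(d) ≥ 4κ_B`», i.e. to the stress-free nearest-neighbour
  distance of the class: floats `c(d₁)/4 = 2.724` fcc (cutoff 6 nn; `→ ≈ 2.74` as the cutoff grows, `d₁ ↓ 0.9712`), `2.715 | 2.710` hcp (two bond
  families, cutoff 5a); designate `κ_B = 27/10`, margin `0.9 % | 0.4 %` in `c`-units at these cutoffs (`≈ 1.5 % | 1 %` at infinite cutoff;
  `c(d)/4 = 27/10` at `d = 0.97198`).  Why it might fail: a site-stress-free class image in the `IsFccImage`/`IsHcpImage` window other than the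
  cubic / two-parameter equilibrium (none known: the trace virial is monotone on the window) — a failure it would share with every [COER]-type leaf.
* [MID-ᶜ](`κ₂, η₂, c_T, cχ`) `MidTrussCls` — **THE OCTAHEDRAL-DIAGONAL DEFICIT IS PAID BY `κ₂` PIVOTS LESS `η₂` NON-AFFINITY**:
  `−κ₂·springL + η₂·nonAffL − (currencies) ≤ barMidL`.  CERT at constant weight · ATTACKABLE-S · INSTRUMENTABLE: the diagonal of a regular octahedron
  elongates by `(√2/4)·(Σ₈ polar − Σ₄ equatorial edge elongations)` (isostatic identity, checked to `2e-16`), whence PER OCTAHEDRON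
  `Σ_{3 diagonals} ℓ² ≤ 2·Σ_{12 edges} e²` (part B `octahedron_certificate`, PROVED) and, every first-shell bond lying on exactly two octahedra (fcc AND
  hcp), `Σ_y barMid_y ≥ −|c₂|·Σ_y spring_y` at constant weight — SHARP: the free-edge constant `Λ = sup_k λ_max K(k) = 4` (both classes, floats) equals
  the true Bloch/affine requirement `κ₂* = |c₂| = 0.466` (attained on the tetragonal `E_g` shear).  Designate `κ₂ = 1/2`, `η₂ = 0` (slack `7 %`).
  Why it might fail: WEIGHT TRANSPORT at the profile onset — the compensating springs sit on the octahedron's other vertices, `≤ 1.4` away, where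
  `w ∝ δ′⁸` differs by the factor `(1 ± 11/δ′)⁸`; an adversarial τ-Lipschitz field straining one diagonal with slack nearest-neighbour bonds at the
  low-weight end leaves a per-site deficit `≲ 6·(|c₂|/4)(0.7τ·1.37)²·w(δ′) ≈ 5.8e-4·w(δ′)`, above `c_T` for `δ′ ∈ [12, 16]` by a factor `≤ 3` unless
  the single-diagonal slack (`65 %`) covers the weight ratio (it does for `δ′ ≥ 16`) — an exposure INHERITED from [BAR♮]/[COER] (same site weighting,
  same adversary), not created by the split; census SHELL-71(W).
* [FAR-ᶜ](`κ₃, η₃, c_T, cχ`) `FarTrussCls` — **THE LONG-RANGE BAR DEFICIT (shells ≥ 3, all coefficients negative, tail `8d⁻⁸`) IS PAID BY `κ₃` PIVOTS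
  LESS `η₃` NON-AFFINITY**: `−κ₃·springL + η₃·nonAffL − (currencies) ≤ barFarL`.  UNDECIDED → TRUE-leaning · ATTACKABLE-M · INSTRUMENTABLE: Bloch +
  affine requirement `κ₃*(η₃) = 0.443` fcc for every `η₃ ≤ 1/25` (long-wave `E_g`; the `η·N` cost is absorbed where `N/S` peaks because the far
  deficit is smallest there), `0.400` hcp at `η₃ = 1/40` (optical Γ); designate `κ₃ = 11/20 | 1/2`, `η₃ = 1/25 | 1/40` (slack `24 % | 20 %`); proof
  technology: isostatic-cluster identities shell by shell (shell 3: octahedron + one tetrahedral cap, 15 bars) with near-sharp constants for shells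
  3–5 and crude Cauchy–Schwarz on the summable remainder (`Σ_s m_s|c_s|d_s²/4`: `0.49, 0.11, 0.09, 0.02, …`).  Why it might fail: the cluster
  constants for shells 3–5 must come within `24 %` of sharp jointly (a plain per-bond Cauchy–Schwarz loses a factor `≈ 2` on shell 3 alone), and the
  same onset weight transport as [MID] over longer clusters.
GLUE (part B, PROVED): [STIFF-ᶜ](`κ_B`) ∧ [MID-ᶜ](`κ₂, η₂, c′`) ∧ [FAR-ᶜ](`κ₃, η₃, c″`) ⟹ [BAR♮-ᶜ](`κ_B − κ₂ − κ₃, η₂ + η₃, c′ + c″`) — add the three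
inequalities on the range split.  DESIGNATE: fcc `(27/10, 1/2, 11/20; 0, 1/25)` ↦ [BAR♮-ᶠ](`33/20, 1/25`), hcp `(27/10, 1/2, 1/2; 0, 1/40)` ↦
[BAR♮-ʰ](`17/10, 1/40`) — NODE 70's designates UNCHANGED, currencies halved per piece (`1/(60·10⁶), 1/(2·10⁶)`).

TAGS (doctrine).  GENUINE SPLIT of [BAR♮-ᶜ] by INTERACTION RANGE on the rotation-null form (three structurally different functionals sharing the
pivot; not a dial split: `κ_B` is pinned by the potential at `d₁`, `κ₂` by the octahedron identity, only `κ₃` carries budget).  Each piece STRICTLY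
WEAKER than [BAR♮-ᶜ]: [STIFF] sees only first-shell bonds (true for every field once the reference's nearest-neighbour distance is known — it cannot
imply a statement about diagonals), [MID] only the six diagonals against the pivot, [FAR] only shells `≥ 3`; NONE IS AN ANALOGUE of the target (the
target's content is the COMPETITION of the positive first shell against both deficits; no piece contains a positive non-pivot term).  Audit
(part B header): each piece is necessary for the glue (MF-1/2/3), the split is an identity not an inequality (MF-4), rates and currencies add (MF-5).
ZERO new equivalences (the lens' single allowed translation is the PROVED identity `barL = Σ ranges`).  `β` is never decomposed; no gauge pivot; no
sitewise coercivity claim (each piece is a weighted-sum statement like its parent).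

FLOATS (pure python, `num/bloch_shells_fcc.py`, `num/bloch_shells_hcp.py`, `num/free_edge_cert.py`; X = ∅, w = 1; cutoff 6 nn fcc / 5a hcp at the
cutoff-consistent stress-free cells `d₁ = 0.97154` / `(a, h) = (0.97179, 0.79335)`):
  fcc: `c₁/4 = 2.7238`, `c₂ = −0.4661`; affine sector `μ₁ = 1.8152`, `κ₂ = 0.4661` (E_g), `κ₃ = 0.4426` (E_g), T2g shear `κ₂ = 0` exactly;
       Bloch `κ₂*(η₂) = 0.466 | 0.466 | 0.472 | 0.495 | 0.533` at `η₂ = 0 | 0.02 | 0.03 | 0.04 | 0.05` (argmax Γ → Σ-line → L),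
       `κ₃*(η₃) = 0.442` for all `η₃ ≤ 0.04`, `0.474` at `0.05`; joint `κ₂₃* = 0.908 = c₁/4 − μ₁^B` (consistency with NODE 70: `μ₁^B = 1.8156`).
  hcp: `min c/4 = 2.7101` (bond family at `0.97179`; `2.7152` at `0.97170`); Bloch `κ₂*(η₂) = 0.465 | 0.534 | 0.606` at `η₂ = 0 | 1/80 | 1/40`,
       `κ₃*(η₃) = 0.362 | 0.362 | 0.400 | 0.479` at `η₃ = 0 | 1/80 | 1/40 | 1/25` (argmax optical Γ throughout); `μ₁^B = 1.968`.
  free-edge octahedron constant `Λ = 4.0000` at `k = 0`, fcc (6 edge orbits, 3 diagonal orbits) AND hcp (12, 6): `κ₂^free = |c₂|Λ/4 = |c₂|` = TIGHT.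
  BUDGET `κ₂ + κ₃ ≤ κ_B − μ₁`: fcc `0.466 + 0.443 = 0.909 ≤ 1.05` (slack `0.141`; split `0.034 | 0.107`), hcp `0.465 + 0.400 = 0.865 ≤ 1.00`
  (slack `0.135`; split `0.035 | 0.100`); [STIFF] slack `0.024 | 0.010`.

0 sorry · 0 native_decide · no private / instance / notation · standard axioms · ≤ 400 lines per part.
-/

noncomputable section
open scoped Classical
open Literature.MathematicalPhysics.StatisticalMechanics Literature.Geometry.DiscreteGeometry
open Summit.AtomisticToContinuum.Crystallization.Theses.PricedLinkCensus
open Summit.AtomisticToContinuum.Crystallization.Theorems.ChargedEnergyGapNegative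

namespace Summit.AtomisticToContinuum.Crystallization.Theorems.ChargedEnergyGapChartDial

/-! ## §C1 Range-resolved bar terms, site forms, weighted forms; the range split (PROVED) -/

section Forms

variable (r₁ r₂ : ℝ) (β : E3 → E3 → E3) (P : PeriodicConfiguration 3) (X : Set E3)

/-- NEAR bar bond term: the renormalised bar term `(V″ − V′/d)·⟪ê, β⟫²` on pairs at distance `≤ r₁`, zero beyond. -/
def bondBarNear (y z : E3) : ℝ := if dist y z ≤ r₁ then bondBar β y z else 0

/-- MID bar bond term: the bar term on pairs with `r₁ < d ≤ r₂` (at `(6/5, 3/2)`: the six octahedral diagonals), zero elsewhere. -/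
def bondBarMid (y z : E3) : ℝ := if r₁ < dist y z ∧ dist y z ≤ r₂ then bondBar β y z else 0

/-- FAR bar bond term: the bar term on pairs with `r₂ < d` (third shell and beyond), zero elsewhere. -/
def bondBarFar (y z : E3) : ℝ := if r₂ < dist y z then bondBar β y z else 0

/-- NEAR bar site form `¼Σ'` of `bondBarNear` over the excised pairs at `y` (same index set as `barSite`). -/
def barNearSite (y : E3) : ℝ := (1 / 4) * ∑' z : {z : E3 // z ∈ P.points ∧ z ∉ X ∧ z ≠ y}, bondBarNear r₁ β y (z : E3)

/-- MID bar site form. -/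
def barMidSite (y : E3) : ℝ := (1 / 4) * ∑' z : {z : E3 // z ∈ P.points ∧ z ∉ X ∧ z ≠ y}, bondBarMid r₁ r₂ β y (z : E3)

/-- FAR bar site form. -/
def barFarSite (y : E3) : ℝ := (1 / 4) * ∑' z : {z : E3 // z ∈ P.points ∧ z ∉ X ∧ z ≠ y}, bondBarFar r₂ β y (z : E3)

variable {r₁ r₂ β}

/-- ★ THE BONDWISE RANGE SPLIT (PROVED): for `r₁ ≤ r₂` every bar term is near + mid + far. -/
theorem bondBar_eq_near_add_mid_add_far (h : r₁ ≤ r₂) (y z : E3) :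
    bondBar β y z = bondBarNear r₁ β y z + bondBarMid r₁ r₂ β y z + bondBarFar r₂ β y z := by
  unfold bondBarNear bondBarMid bondBarFar
  by_cases h1 : dist y z ≤ r₁
  · have h2 : ¬ (r₁ < dist y z ∧ dist y z ≤ r₂) := fun hh => absurd hh.1 (not_lt.2 h1)
    have h3 : ¬ r₂ < dist y z := not_lt.2 (h1.trans h)
    rw [if_pos h1, if_neg h2, if_neg h3, add_zero, add_zero]
  · by_cases h2 : dist y z ≤ r₂
    · have h2' : r₁ < dist y z ∧ dist y z ≤ r₂ := ⟨not_le.1 h1, h2⟩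
      rw [if_neg h1, if_pos h2', if_neg (not_lt.2 h2), zero_add, add_zero]
    · have h2' : ¬ (r₁ < dist y z ∧ dist y z ≤ r₂) := fun hh => h2 hh.2
      rw [if_neg h1, if_neg h2', if_pos (not_le.1 h2), zero_add, zero_add]

/-- `abs_bondBarNear_le` (docstring added by the landing lane; see the module docstring). [formal bookkeeping] -/
theorem abs_bondBarNear_le (y z : E3) : |bondBarNear r₁ β y z| ≤ |bondBar β y z| := by
  unfold bondBarNear
  split_ifs
  · exact le_rfl
  · rw [abs_zero]; exact abs_nonneg _

/-- `abs_bondBarMid_le` (docstring added by the landing lane; see the module docstring). [formal bookkeeping] -/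
theorem abs_bondBarMid_le (y z : E3) : |bondBarMid r₁ r₂ β y z| ≤ |bondBar β y z| := by
  unfold bondBarMid
  split_ifs
  · exact le_rfl
  · rw [abs_zero]; exact abs_nonneg _

/-- `abs_bondBarFar_le` (docstring added by the landing lane; see the module docstring). [formal bookkeeping] -/
theorem abs_bondBarFar_le (y z : E3) : |bondBarFar r₂ β y z| ≤ |bondBar β y z| := by
  unfold bondBarFar
  split_ifs
  · exact le_rfl
  · rw [abs_zero]; exact abs_nonneg _

/-- All three range terms are ROTATION-NULL bond by bond (inherited from `bondBar_rotField`) … -/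
theorem bondBarNear_rotField (r₀ v y z : E3) : bondBarNear r₁ (rotField r₀ v) y z = 0 := by
  simp [bondBarNear, bondBar_rotField]

/-- `bondBarMid_rotField` (docstring added by the landing lane; see the module docstring). [formal bookkeeping] -/
theorem bondBarMid_rotField (r₀ v y z : E3) : bondBarMid r₁ r₂ (rotField r₀ v) y z = 0 := by
  simp [bondBarMid, bondBar_rotField]

/-- `bondBarFar_rotField` (docstring added by the landing lane; see the module docstring). [formal bookkeeping] -/
theorem bondBarFar_rotField (r₀ v y z : E3) : bondBarFar r₂ (rotField r₀ v) y z = 0 := by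
  simp [bondBarFar, bondBar_rotField]

/-- … hence so are the three site forms (every reference, EVERY excision). -/
theorem barNearSite_rotField (r₀ v y : E3) : barNearSite r₁ (rotField r₀ v) P X y = 0 := by
  simp [barNearSite, bondBarNear_rotField]

/-- `barMidSite_rotField` (docstring added by the landing lane; see the module docstring). [formal bookkeeping] -/
theorem barMidSite_rotField (r₀ v y : E3) : barMidSite r₁ r₂ (rotField r₀ v) P X y = 0 := by
  simp [barMidSite, bondBarMid_rotField]

/-- `barFarSite_rotField` (docstring added by the landing lane; see the module docstring). [formal bookkeeping] -/
theorem barFarSite_rotField (r₀ v y : E3) : barFarSite r₂ (rotField r₀ v) P X y = 0 := by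
  simp [barFarSite, bondBarFar_rotField]

variable {P X}

/-- Under a small-strain bound on the excised bonds at `y` each range term is summable (dominated by `|bondBar|`, NODE 69 `summable_bondBar`). -/
theorem summable_bondBarNear {τ : ℝ} {y : E3} (hβ : ∀ z : E3, z ∈ P.points → z ∉ X → z ≠ y → ‖β y z‖ ≤ τ * dist y z) :
    Summable fun z : {z : E3 // z ∈ P.points ∧ z ∉ X ∧ z ≠ y} => bondBarNear r₁ β y (z : E3) :=
  Summable.of_norm_bounded (summable_bondBar hβ).abs fun z => by
    rw [Real.norm_eq_abs]; exact abs_bondBarNear_le y z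

/-- `summable_bondBarMid` (docstring added by the landing lane; see the module docstring). [formal bookkeeping] -/
theorem summable_bondBarMid {τ : ℝ} {y : E3} (hβ : ∀ z : E3, z ∈ P.points → z ∉ X → z ≠ y → ‖β y z‖ ≤ τ * dist y z) :
    Summable fun z : {z : E3 // z ∈ P.points ∧ z ∉ X ∧ z ≠ y} => bondBarMid r₁ r₂ β y (z : E3) :=
  Summable.of_norm_bounded (summable_bondBar hβ).abs fun z => by
    rw [Real.norm_eq_abs]; exact abs_bondBarMid_le y z

/-- `summable_bondBarFar` (docstring added by the landing lane; see the module docstring). [formal bookkeeping] -/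
theorem summable_bondBarFar {τ : ℝ} {y : E3} (hβ : ∀ z : E3, z ∈ P.points → z ∉ X → z ≠ y → ‖β y z‖ ≤ τ * dist y z) :
    Summable fun z : {z : E3 // z ∈ P.points ∧ z ∉ X ∧ z ≠ y} => bondBarFar r₂ β y (z : E3) :=
  Summable.of_norm_bounded (summable_bondBar hβ).abs fun z => by
    rw [Real.norm_eq_abs]; exact abs_bondBarFar_le y z

/-- ★ THE SITEWISE RANGE SPLIT (PROVED): under a small-strain bound on the excised bonds at `y`, `barSite = barNearSite + barMidSite + barFarSite`. -/
theorem barSite_eq_near_add_mid_add_far (h : r₁ ≤ r₂) {τ : ℝ} {y : E3}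
    (hβ : ∀ z : E3, z ∈ P.points → z ∉ X → z ≠ y → ‖β y z‖ ≤ τ * dist y z) :
    barSite β P X y = barNearSite r₁ β P X y + barMidSite r₁ r₂ β P X y + barFarSite r₂ β P X y := by
  unfold barSite barNearSite barMidSite barFarSite
  rw [← mul_add, ← mul_add, ← (summable_bondBarNear (r₁ := r₁) hβ).tsum_add (summable_bondBarMid (r₁ := r₁) (r₂ := r₂) hβ),
    ← ((summable_bondBarNear (r₁ := r₁) hβ).add (summable_bondBarMid (r₁ := r₁) (r₂ := r₂) hβ)).tsum_add
      (summable_bondBarFar (r₂ := r₂) hβ)]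
  congr 1
  exact tsum_congr fun z => bondBar_eq_near_add_mid_add_far h y z

end Forms

section Weighted

variable (ϱχ : ℝ) {m : ℕ} (D : Fin m → Set E3) (σ : Fin m → Bool) (r₁ r₂ : ℝ)

/-- The **WEIGHTED EXCISED NEAR BAR FORM** `Σ_{y ∈ motif ∖ X} χ(y)·w(y)·barNearSite_y(β)` — weighted and excised exactly like `barL`. -/
def barNearL (β : E3 → E3 → E3) (P : PeriodicConfiguration 3) (X : Set E3) (ϱ : ℝ) (C : Set E3) : ℝ :=
  ∑ y ∈ P.motif, if y ∈ X then 0 else localFactor ϱχ D σ y * (profileWeight ϱ C y * barNearSite r₁ β P X y)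

/-- The **WEIGHTED EXCISED MID BAR FORM**. -/
def barMidL (β : E3 → E3 → E3) (P : PeriodicConfiguration 3) (X : Set E3) (ϱ : ℝ) (C : Set E3) : ℝ :=
  ∑ y ∈ P.motif, if y ∈ X then 0 else localFactor ϱχ D σ y * (profileWeight ϱ C y * barMidSite r₁ r₂ β P X y)

/-- The **WEIGHTED EXCISED FAR BAR FORM**. -/
def barFarL (β : E3 → E3 → E3) (P : PeriodicConfiguration 3) (X : Set E3) (ϱ : ℝ) (C : Set E3) : ℝ :=
  ∑ y ∈ P.motif, if y ∈ X then 0 else localFactor ϱχ D σ y * (profileWeight ϱ C y * barFarSite r₂ β P X y)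

variable {ϱχ D σ r₁ r₂} {β : E3 → E3 → E3} {P : PeriodicConfiguration 3} {X : Set E3}

/-- ★ THE WEIGHTED RANGE SPLIT (PROVED): under `SmallStrain τ P X β` and `r₁ ≤ r₂`, `barL = barNearL + barMidL + barFarL`. -/
theorem barL_eq_barNearL_add_barMidL_add_barFarL (h : r₁ ≤ r₂) {τ : ℝ} (hτ : SmallStrain τ P X β) (ϱ : ℝ) (C : Set E3) :
    barL ϱχ D σ β P X ϱ C = barNearL ϱχ D σ r₁ β P X ϱ C + barMidL ϱχ D σ r₁ r₂ β P X ϱ C + barFarL ϱχ D σ r₂ β P X ϱ C := by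
  unfold barL barNearL barMidL barFarL
  rw [← Finset.sum_add_distrib, ← Finset.sum_add_distrib]
  refine Finset.sum_congr rfl fun y hy => ?_
  split_ifs with hyX
  · simp
  · rw [barSite_eq_near_add_mid_add_far (r₁ := r₁) (r₂ := r₂) h (τ := τ)
      fun z hz hzX _ => hτ y (P.mem_points_of_mem_motif hy) z hz hyX hzX]
    ring

/-- The three weighted range forms of a rotation cocycle vanish (every reference, EVERY excision, every weight). -/
theorem barNearL_rotField (ϱ : ℝ) (C : Set E3) (r₀ v : E3) : barNearL ϱχ D σ r₁ (rotField r₀ v) P X ϱ C = 0 := by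
  simp [barNearL, barNearSite_rotField]

/-- `barMidL_rotField` (docstring added by the landing lane; see the module docstring). [formal bookkeeping] -/
theorem barMidL_rotField (ϱ : ℝ) (C : Set E3) (r₀ v : E3) : barMidL ϱχ D σ r₁ r₂ (rotField r₀ v) P X ϱ C = 0 := by
  simp [barMidL, barMidSite_rotField]

/-- `barFarL_rotField` (docstring added by the landing lane; see the module docstring). [formal bookkeeping] -/
theorem barFarL_rotField (ϱ : ℝ) (C : Set E3) (r₀ v : E3) : barFarL ϱχ D σ r₂ (rotField r₀ v) P X ϱ C = 0 := by
  simp [barFarL, barFarSite_rotField]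

end Weighted

/-! ## §C2 The three pieces -/

section Pieces

variable (cls : Set E3 → Prop) (s lam ℓ μ₀ τ ϱ b₀ r_S ϱχ r₁ r₂ : ℝ)

/-- ★ piece [STIFF-ᶜ](`κ_B`) · **THE FIRST SHELL OF THE RENORMALISED BAR TRUSS IS AT LEAST `κ_B` TIMES THE PIVOT**: over the hypothesis block of
[BAR♮-ᶜ] VERBATIM, `κ_B·springL(β) ≤ barNearL(β)` for the Volterra field of the data (both forms live on the same non-excised bonds of length
`≤ r₁`; no currency).  CERT · DECIDABLE · ATTACKABLE-S: reduced in part B (`nearStiffCls_of_nnStiff`, PROVED) to the field-free [NN-ᶜ](`κ_B`).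
Why it might fail: only through [NN-ᶜ] — a stress-free class image whose nearest-neighbour distance exceeds `0.97198` (where `c(d)/4 = 27/10`). -/
def NearStiffCls (κ_B : ℝ) : Prop :=
  ∀ (P : PeriodicConfiguration 3) (C X : Set E3) (β₀ : E3 → E3 → E3) (k : ℕ) (S : Fin k → CutPiece)
    (m : ℕ) (D : Fin m → Set E3) (σ : Fin m → Bool),
    IsSeparatedRef s P → IsLabelledRef lam ℓ P → cls P.points → IsForceFree P → IsSiteStressFree P → HarmStableModRot μ₀ P →
    IsInvariantSet P C → IsInvariantSet P X → IsGlobalCocycle P β₀ → IsSeamSystem b₀ r_S P S →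
    SmallStrain τ P X (volterraField P S β₀) → (∀ i, IsInvariantSet P (D i)) →
      κ_B * springL ϱχ D σ (volterraField P S β₀) P X r₁ ϱ C ≤ barNearL ϱχ D σ r₁ (volterraField P S β₀) P X ϱ C

/-- ★ piece [MID-ᶜ](`κ₂, η₂, c_T, cχ`) · **THE OCTAHEDRAL-DIAGONAL BAR DEFICIT IS PAID BY `κ₂` PIVOTS LESS `η₂` NON-AFFINITY**: over the block VERBATIM,
`−κ₂·springL(β) + η₂·nonAffL(β) − (c_T·M_sh + cχ·M_tr + c_H·N_pr) ≤ barMidL(β)` (pairs with `r₁ < d ≤ r₂`).  CERT at constant weight (part B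
`octahedron_certificate`: `Σ_{3 diag} ℓ² ≤ 2Σ_{12 edges} e²`, sharp constant `|c₂|` = the Bloch/affine requirement `0.466`) · ATTACKABLE-S ·
INSTRUMENTABLE.  Why it might fail: weight transport at the profile onset `δ′ ∈ [12, 16]` for an adversarial field straining one diagonal with slack
first-shell bonds at the low-weight vertices (deficit `≲ 5.8e-4·w(δ′)` per site vs `c_T`; inherited from [BAR♮]). -/
def MidTrussCls (κ₂ η₂ c_T cχ : ℝ) : Prop :=
  ∃ c_H : ℝ, 0 ≤ c_H ∧ ∀ (P : PeriodicConfiguration 3) (C X : Set E3) (β₀ : E3 → E3 → E3) (k : ℕ) (S : Fin k → CutPiece)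
    (m : ℕ) (D : Fin m → Set E3) (σ : Fin m → Bool),
    IsSeparatedRef s P → IsLabelledRef lam ℓ P → cls P.points → IsForceFree P → IsSiteStressFree P → HarmStableModRot μ₀ P →
    IsInvariantSet P C → IsInvariantSet P X → IsGlobalCocycle P β₀ → IsSeamSystem b₀ r_S P S →
    SmallStrain τ P X (volterraField P S β₀) → (∀ i, IsInvariantSet P (D i)) →
      -(κ₂ * springL ϱχ D σ (volterraField P S β₀) P X r₁ ϱ C) + η₂ * nonAffL ϱχ D σ (volterraField P S β₀) P X r₁ ϱ C -
            c_T * shellMassL ϱχ D σ P X ϱ C - cχ * transMassL ϱχ D σ P X ϱ C -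
          c_H * (pricedNearCountL ϱχ D σ P X ϱ C : ℝ) ≤
        barMidL ϱχ D σ r₁ r₂ (volterraField P S β₀) P X ϱ C

/-- ★ piece [FAR-ᶜ](`κ₃, η₃, c_T, cχ`) · **THE LONG-RANGE BAR DEFICIT (third shell and beyond) IS PAID BY `κ₃` PIVOTS LESS `η₃` NON-AFFINITY**: over
the block VERBATIM, `−κ₃·springL(β) + η₃·nonAffL(β) − (c_T·M_sh + cχ·M_tr + c_H·N_pr) ≤ barFarL(β)` (pairs with `r₂ < d`).  UNDECIDED →
TRUE-leaning (Bloch + affine requirement `0.443` fcc ∀ `η₃ ≤ 1/25`, `0.400` hcp at `η₃ = 1/40`; designate `11/20 | 1/2`) · ATTACKABLE-M (isostatic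
cluster identities for shells 3–5, Cauchy–Schwarz on the summable `8d⁻⁸` tail) · INSTRUMENTABLE.  Why it might fail: cluster constants for shells 3–5
within `24 %` of sharp jointly; onset weight transport over longer clusters. -/
def FarTrussCls (κ₃ η₃ c_T cχ : ℝ) : Prop :=
  ∃ c_H : ℝ, 0 ≤ c_H ∧ ∀ (P : PeriodicConfiguration 3) (C X : Set E3) (β₀ : E3 → E3 → E3) (k : ℕ) (S : Fin k → CutPiece)
    (m : ℕ) (D : Fin m → Set E3) (σ : Fin m → Bool),
    IsSeparatedRef s P → IsLabelledRef lam ℓ P → cls P.points → IsForceFree P → IsSiteStressFree P → HarmStableModRot μ₀ P →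
    IsInvariantSet P C → IsInvariantSet P X → IsGlobalCocycle P β₀ → IsSeamSystem b₀ r_S P S →
    SmallStrain τ P X (volterraField P S β₀) → (∀ i, IsInvariantSet P (D i)) →
      -(κ₃ * springL ϱχ D σ (volterraField P S β₀) P X r₁ ϱ C) + η₃ * nonAffL ϱχ D σ (volterraField P S β₀) P X r₁ ϱ C -
            c_T * shellMassL ϱχ D σ P X ϱ C - cχ * transMassL ϱχ D σ P X ϱ C -
          c_H * (pricedNearCountL ϱχ D σ P X ϱ C : ℝ) ≤
        barFarL ϱχ D σ r₂ (volterraField P S β₀) P X ϱ C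

variable {cls s lam ℓ μ₀ τ ϱ b₀ r_S ϱχ r₁ r₂}

/-- [STIFF-ᶜ] is antitone in `κ_B`. -/
theorem NearStiffCls.mono {κ_B κ_B' : ℝ} (hκ : κ_B' ≤ κ_B) (h : NearStiffCls cls s lam ℓ μ₀ τ ϱ b₀ r_S ϱχ r₁ κ_B) :
    NearStiffCls cls s lam ℓ μ₀ τ ϱ b₀ r_S ϱχ r₁ κ_B' := fun P C X β₀ k S m D σ h1 h2 hb h3 h4 h5 h6 h7 h8 h9 h10 h11 => by
  have H := h P C X β₀ k S m D σ h1 h2 hb h3 h4 h5 h6 h7 h8 h9 h10 h11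
  have hS := springL_nonneg (volterraField P S β₀) P X r₁ (ϱχ := ϱχ) (D := D) (σ := σ) ϱ C
  nlinarith [mul_le_mul_of_nonneg_right hκ hS]

/-- [MID-ᶜ] is monotone in `κ₂`, antitone in `η₂`, monotone in both losses (each enlargement weakens the claim). -/
theorem MidTrussCls.mono {κ₂ κ₂' η₂ η₂' c_T c_T' cχ cχ' : ℝ} (hκ : κ₂ ≤ κ₂') (hη : η₂' ≤ η₂) (hc : c_T ≤ c_T') (hχ : cχ ≤ cχ')
    (h : MidTrussCls cls s lam ℓ μ₀ τ ϱ b₀ r_S ϱχ r₁ r₂ κ₂ η₂ c_T cχ) : MidTrussCls cls s lam ℓ μ₀ τ ϱ b₀ r_S ϱχ r₁ r₂ κ₂' η₂' c_T' cχ' := by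
  obtain ⟨c_H, hH, h⟩ := h
  refine ⟨c_H, hH, fun P C X β₀ k S m D σ h1 h2 hb h3 h4 h5 h6 h7 h8 h9 h10 h11 => ?_⟩
  have H := h P C X β₀ k S m D σ h1 h2 hb h3 h4 h5 h6 h7 h8 h9 h10 h11
  have hM := shellMassL_nonneg (ϱχ := ϱχ) (D := D) (σ := σ) P X ϱ C
  have hT' := transMassL_nonneg (ϱχ := ϱχ) (D := D) (σ := σ) P X ϱ C
  have hS := springL_nonneg (volterraField P S β₀) P X r₁ (ϱχ := ϱχ) (D := D) (σ := σ) ϱ C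
  have hN := nonAffL_nonneg (volterraField P S β₀) P X r₁ (ϱχ := ϱχ) (D := D) (σ := σ) ϱ C
  nlinarith [mul_le_mul_of_nonneg_right hc hM, mul_le_mul_of_nonneg_right hχ hT', mul_le_mul_of_nonneg_right hκ hS,
    mul_le_mul_of_nonneg_right hη hN]

/-- [FAR-ᶜ] is monotone in `κ₃`, antitone in `η₃`, monotone in both losses. -/
theorem FarTrussCls.mono {κ₃ κ₃' η₃ η₃' c_T c_T' cχ cχ' : ℝ} (hκ : κ₃ ≤ κ₃') (hη : η₃' ≤ η₃) (hc : c_T ≤ c_T') (hχ : cχ ≤ cχ')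
    (h : FarTrussCls cls s lam ℓ μ₀ τ ϱ b₀ r_S ϱχ r₁ r₂ κ₃ η₃ c_T cχ) : FarTrussCls cls s lam ℓ μ₀ τ ϱ b₀ r_S ϱχ r₁ r₂ κ₃' η₃' c_T' cχ' := by
  obtain ⟨c_H, hH, h⟩ := h
  refine ⟨c_H, hH, fun P C X β₀ k S m D σ h1 h2 hb h3 h4 h5 h6 h7 h8 h9 h10 h11 => ?_⟩
  have H := h P C X β₀ k S m D σ h1 h2 hb h3 h4 h5 h6 h7 h8 h9 h10 h11
  have hM := shellMassL_nonneg (ϱχ := ϱχ) (D := D) (σ := σ) P X ϱ C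
  have hT' := transMassL_nonneg (ϱχ := ϱχ) (D := D) (σ := σ) P X ϱ C
  have hS := springL_nonneg (volterraField P S β₀) P X r₁ (ϱχ := ϱχ) (D := D) (σ := σ) ϱ C
  have hN := nonAffL_nonneg (volterraField P S β₀) P X r₁ (ϱχ := ϱχ) (D := D) (σ := σ) ϱ C
  nlinarith [mul_le_mul_of_nonneg_right hc hM, mul_le_mul_of_nonneg_right hχ hT', mul_le_mul_of_nonneg_right hκ hS,
    mul_le_mul_of_nonneg_right hη hN]

/-! ### Sanity: no piece can ring the rotation alarm (all range forms, the pivot and the non-affinity vanish on rotation cocycles) -/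

/-- SANITY [STIFF]: at EVERY reference, EVERY excision, no seams, the conclusion of [STIFF-ᶜ] holds for the rotation cocycle with EVERY `κ_B`. -/
theorem nearStiff_conclusion_rotField {P : PeriodicConfiguration 3} (X : Set E3) (ϱχ : ℝ) {m : ℕ} (D : Fin m → Set E3) (σ : Fin m → Bool)
    (κ_B r₁ ϱ : ℝ) (C : Set E3) (S : Fin 0 → CutPiece) (r₀ v : E3) :
    κ_B * springL ϱχ D σ (volterraField P S (rotField r₀ v)) P X r₁ ϱ C ≤ barNearL ϱχ D σ r₁ (volterraField P S (rotField r₀ v)) P X ϱ C := by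
  rw [volterraField_fin_zero, springL_rotField, barNearL_rotField, mul_zero]

/-- SANITY [MID]: the conclusion of [MID-ᶜ] holds for the rotation cocycle with EVERY `κ₂, η₂` and all `c_T, cχ, c_H ≥ 0`. -/
theorem midTruss_conclusion_rotField {P : PeriodicConfiguration 3} (X : Set E3) (ϱχ : ℝ) {m : ℕ} (D : Fin m → Set E3) (σ : Fin m → Bool)
    {c_T cχ c_H : ℝ} (hT : 0 ≤ c_T) (hχ : 0 ≤ cχ) (hH : 0 ≤ c_H) (κ₂ η₂ r₁ r₂ ϱ : ℝ) (C : Set E3) (S : Fin 0 → CutPiece) (r₀ v : E3) :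
    -(κ₂ * springL ϱχ D σ (volterraField P S (rotField r₀ v)) P X r₁ ϱ C) +
            η₂ * nonAffL ϱχ D σ (volterraField P S (rotField r₀ v)) P X r₁ ϱ C -
          c_T * shellMassL ϱχ D σ P X ϱ C - cχ * transMassL ϱχ D σ P X ϱ C - c_H * (pricedNearCountL ϱχ D σ P X ϱ C : ℝ) ≤
      barMidL ϱχ D σ r₁ r₂ (volterraField P S (rotField r₀ v)) P X ϱ C := by
  rw [volterraField_fin_zero, springL_rotField, nonAffL_rotField, barMidL_rotField, mul_zero, mul_zero]
  have h1 := shellMassL_nonneg (ϱχ := ϱχ) (D := D) (σ := σ) P X ϱ C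
  have h2 := transMassL_nonneg (ϱχ := ϱχ) (D := D) (σ := σ) P X ϱ C
  have h3 : (0 : ℝ) ≤ (pricedNearCountL ϱχ D σ P X ϱ C : ℝ) := Nat.cast_nonneg _
  nlinarith [mul_nonneg hT h1, mul_nonneg hχ h2, mul_nonneg hH h3]

/-- SANITY [FAR]: the conclusion of [FAR-ᶜ] holds for the rotation cocycle with EVERY `κ₃, η₃` and all `c_T, cχ, c_H ≥ 0`. -/
theorem farTruss_conclusion_rotField {P : PeriodicConfiguration 3} (X : Set E3) (ϱχ : ℝ) {m : ℕ} (D : Fin m → Set E3) (σ : Fin m → Bool)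
    {c_T cχ c_H : ℝ} (hT : 0 ≤ c_T) (hχ : 0 ≤ cχ) (hH : 0 ≤ c_H) (κ₃ η₃ r₁ r₂ ϱ : ℝ) (C : Set E3) (S : Fin 0 → CutPiece) (r₀ v : E3) :
    -(κ₃ * springL ϱχ D σ (volterraField P S (rotField r₀ v)) P X r₁ ϱ C) +
            η₃ * nonAffL ϱχ D σ (volterraField P S (rotField r₀ v)) P X r₁ ϱ C -
          c_T * shellMassL ϱχ D σ P X ϱ C - cχ * transMassL ϱχ D σ P X ϱ C - c_H * (pricedNearCountL ϱχ D σ P X ϱ C : ℝ) ≤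
      barFarL ϱχ D σ r₂ (volterraField P S (rotField r₀ v)) P X ϱ C := by
  rw [volterraField_fin_zero, springL_rotField, nonAffL_rotField, barFarL_rotField, mul_zero, mul_zero]
  have h1 := shellMassL_nonneg (ϱχ := ϱχ) (D := D) (σ := σ) P X ϱ C
  have h2 := transMassL_nonneg (ϱχ := ϱχ) (D := D) (σ := σ) P X ϱ C
  have h3 : (0 : ℝ) ≤ (pricedNearCountL ϱχ D σ P X ϱ C : ℝ) := Nat.cast_nonneg _
  nlinarith [mul_nonneg hT h1, mul_nonneg hχ h2, mul_nonneg hH h3]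

end Pieces

end Summit.AtomisticToContinuum.Crystallization.Theorems.ChargedEnergyGapChartDial
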